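import Literature.MathematicalPhysics.QuantumFieldTheory.Balaban1983to89.Node00.MultiScaleFibreChartTwist
import Literature.MathematicalPhysics.QuantumFieldTheory.Balaban1983to89.Node00.MultiScaleFibreChartB

/-!
# NODE 00 — THE BOND-DATUM CHART `msChartB` IS LINEAR ALONG FAMILIES WHOSE CONSTRAINED AVERAGES ARE LEFT TRANSLATES OF THE DATUM (`haff` holds identically) — the print-datum
# ([Balaban1984PropagatorsII] (2.3)) edition of `Node00/MultiScaleFibreChartTwist` §Twist–§Family (its §Lie is datum-free and REUSED), keyed on the lane's `Node00/MultiScaleFibreChartB`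

statement-level skeleton of published theorems with citation tags; proofs where landed; nothing here is a claim about
the Yang–Mills mass gap

Cell `pub-ymgap` (HUMAN RULINGS D-0062 ∕ D-0149), lane `pub-ymgap-dag-n12-c` g35 (R134 seat (a), N12 = [B15], s1, lane owner); `--kind proof --supports` K1⁹ `stmt-QuantumFields-27364`;
count-neutral.  THEOREMS ONLY (0 `def`, 0 `instance`, 0 `sorry`).  (E1) variant (iii-b), class (γ) of the lane's census-by-declaration v2 (bus [DAGN12C-G35], 2026-08-30; v2 adds the triggers
`DetSet ∕ msChart ∕ ConstrSet ∕ constrCard ∕ constrEnum ∕ IsFibreChart*`: EIGHT declarations of this parent are used by N12's junction of record v14ᴸ — `eventually_msChart_family_eq_affine`,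
`eventually_norm_coe_apply_lt_log_two`, `fderiv_fderiv_msChart_family_eq_zero`, `fderiv_msChart_comp_apply_eq_ad`, `fderiv_msChart_family_apply`, `haff_msChart_of_avg_family`,
`hasFDerivAt_msChart_family`, `msChart_eq_ad_of_avg_eq`).  The parent reads its determining set ONLY through the index type `ConstrSet 𝐁 k` and the chart, so the twin is a GENERATOR file
(`DetSet ↦ BDetSet`, `ConstrSet ∕ constrCard ∕ constrEnum ∕ msChart ↦ …B`; proofs VERBATIM; the two decls whose names do not mention the chart get the suffix `_constrB`).

HONESTY GUARD (director-ym №338 (5)).  PURELY ADDITIVE: the parent stays landed and true on its own text; nothing in it is edited; no displayed premise of any consumer is deleted or weakened.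
Kernel calculus; nothing of [15] asserted; K0⁷ ∕ K1⁹ NOT closed; N07 ∕ N12 NOT discharged; one finite 𝕋⁴ programme at fixed ε — NOT continuum ∕ ℝ⁴ ∕ OS ∕ mass gap ∕ Clay.

WHAT IS HERE.  §Twist `msChartB_eq_ad_of_avg_eq`; §Family `eventually_norm_coe_apply_lt_log_two_constrB` · `pi_ad_comp_apply_constrB` · ★★ `eventually_msChartB_family_eq_affine` · ★★
`fderiv_fderiv_msChartB_family_eq_zero` · ★★★ `haff_msChartB_of_avg_family` · `hasFDerivAt_msChartB_family` · `fderiv_msChartB_family_apply` · ★★ `fderiv_msChartB_comp_apply_eq_ad`.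

References: [Balaban1989LargeFieldII] (1.7) p.358, (1.12)–(1.13) p.359, (1.19) p.360; [15] = [Balaban1985Variational] Sect. C (44)–(48) p.285, (81)–(83) p.290; [III] = [Balaban1988Convergent] (2.10)–(2.12)
p.256; [Balaban1985Averaging] (17)–(26) pp.21–22; [II] = [Balaban1984PropagatorsII] (2.3) p.224.
-/

noncomputable section

namespace Literature.MathematicalPhysics.QuantumFieldTheory.Balaban1983to89.Node00

open Filter Topology
open T4Continuum (T4Family)
open B15DeterminingSets B15DeterminingSetsB
open MatrixLog (mlog)
open T4AdjointCovarianceUnitary (lieSU expSU coe_expSU specialUnitaryAd coe_specialUnitaryAd expSU_specialUnitaryAd)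
open scoped Matrix.Norms.L2Operator

section Twist

variable {F : T4Family} {N : ℕ} [NeZero N]
variable {K k : ℕ} {𝔅 : BDetSet (F.P K)} {W : MSField (F.P K) (SU N)} {U : GaugeField (F.P K) 0 (SU N)}

/-- ★★ **THE CHART IS THE TWISTED LIE FAMILY WHEREVER THE CONSTRAINED AVERAGES ARE LEFT TRANSLATES OF THE DATUM**: if at the chart point `X` every constrained average is
`Ū^j(U·e^X)(c) = e^{Z_{(j,c)}}·W_j(c)` with `‖Z_{(j,c)}‖ < ln 2`, then the `(j,c)`-component of `msChartB F N K k 𝐁 W U X` is `Ad_{W_j(c)⁻¹} Z_{(j,c)}` (the TWISTED EMBEDDING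
`Z ↦ (Ad_{W_j(c)⁻¹} Z_{(j,c)})_{(j,c)}`, re-indexed by the chart's enumeration — linear in `Z`).
[cite: Balaban1985Variational, Sect. C (47)–(48) p.285, (82)–(83) p.290; Balaban1988Convergent, (2.10)–(2.12) p.256] -/
theorem msChartB_eq_ad_of_avg_eq {X : PBond (F.P K) 0 → lieSU (Fin N)} {Z : ConstrSetB 𝔅 k → lieSU (Fin N)}
    (hZ : ∀ s, ‖(Z s : Matrix (Fin N) (Fin N) ℂ)‖ < Real.log 2)
    (havg : ∀ s : ConstrSetB 𝔅 k, avgFamily (avOfRecord F N K) (expChart U X) s.1 s.2.1 = expSU (Z s) * W s.1 s.2.1) :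
    msChartB F N K k 𝔅 W U X = fun i =>
      specialUnitaryAd (W ((constrEnumB 𝔅 k).symm i).1 ((constrEnumB 𝔅 k).symm i).2.1)⁻¹ (Z ((constrEnumB 𝔅 k).symm i)) := by
  funext i
  rw [msChartB_apply, relAvg, havg, Submonoid.coe_mul, coe_expSU, ← mul_assoc]
  exact suProj_mlog_star_coe_mul_exp_mul_coe _ (hZ _)

end Twist

/-! ## §3  Along a family: the chart is eventually linear, its second derivative vanishes, its first derivative is the twisted embedding -/

section Family

variable {F : T4Family} {N : ℕ} [NeZero N]
variable {K k : ℕ} {𝔅 : BDetSet (F.P K)} {W : MSField (F.P K) (SU N)} {U : GaugeField (F.P K) 0 (SU N)}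
variable {G : Type*} [NormedAddCommGroup G] [NormedSpace ℝ G]

omit [NeZero N] in
/-- A linear family of Lie elements is eventually inside the radius `ln 2` of `log ∘ exp = id`. [cite: Balaban1985Averaging, (21)–(26) pp.21–22 (bookkeeping)] -/
theorem eventually_norm_coe_apply_lt_log_two_constrB (Zf : G →L[ℝ] (ConstrSetB 𝔅 k → lieSU (Fin N))) (g₀ : G) :
    ∀ᶠ g in 𝓝 g₀, ∀ s, ‖((Zf (g - g₀) s : lieSU (Fin N)) : Matrix (Fin N) (Fin N) ℂ)‖ < Real.log 2 := by
  refine eventually_all.2 fun s => ?_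
  have hc : Continuous fun g : G => ‖((Zf (g - g₀) s : lieSU (Fin N)) : Matrix (Fin N) (Fin N) ℂ)‖ :=
    ((continuous_subtype_val.comp ((continuous_apply s).comp (Zf.continuous.comp (continuous_id.sub continuous_const)))).norm)
  have h0 : ‖((Zf (g₀ - g₀) s : lieSU (Fin N)) : Matrix (Fin N) (Fin N) ℂ)‖ < Real.log 2 := by
    rw [sub_self, map_zero, Pi.zero_apply, ZeroMemClass.coe_zero, norm_zero]
    exact Real.log_pos one_lt_two
  exact hc.continuousAt.eventually_lt_const h0

omit [NeZero N] in
/-- The twisted embedding composed with a linear Lie family, as ONE continuous linear map `G → (Fin #𝐁 → 𝔰𝔲(N))`, evaluated: its `i`-th component at `h` is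
`Ad_{W_j(c)⁻¹} (Z h)_{(j,c)}`, `(j,c)` the `i`-th constrained bond. [cite: Balaban1985Variational, (82)–(83) p.290 (bookkeeping)] -/
theorem pi_ad_comp_apply_constrB (Zf : G →L[ℝ] (ConstrSetB 𝔅 k → lieSU (Fin N))) (h : G) (i : Fin (constrCardB 𝔅 k)) :
    (ContinuousLinearMap.pi fun i : Fin (constrCardB 𝔅 k) =>
        (specialUnitaryAd (W ((constrEnumB 𝔅 k).symm i).1 ((constrEnumB 𝔅 k).symm i).2.1)⁻¹).toContinuousLinearEquiv.toContinuousLinearMap.comp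
          ((ContinuousLinearMap.proj ((constrEnumB 𝔅 k).symm i)).comp Zf)) h i
      = specialUnitaryAd (W ((constrEnumB 𝔅 k).symm i).1 ((constrEnumB 𝔅 k).symm i).2.1)⁻¹ (Zf h ((constrEnumB 𝔅 k).symm i)) := rfl

/-- ★★ **ALONG A FAMILY WHOSE CONSTRAINED AVERAGES ARE LEFT TRANSLATES BY A LINEAR LIE FAMILY, THE CHART IS EVENTUALLY LINEAR**:
`(∀ᶠ g, ∀ (j,c), Ū^j(U·e^{X_f g})(c) = e^{Z(g − g₀)_{(j,c)}}·W_j(c))` ⇒ `∀ᶠ g, msChartB … (X_f g) = 0 + ℓ(g − g₀)` with `ℓ` the twisted embedding composed with `Z` (the affine shape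
of `B16Ineq17NearFlatOneSidedDatum.fderiv_fderiv_datum_eq_zero_of_eventually_affine`, `v₀ = 0`). [cite: Balaban1985Variational, Sect. C (47)–(48) p.285, (82)–(83) p.290; Balaban1989LargeFieldII, (1.7) p.358, p.359] -/
theorem eventually_msChartB_family_eq_affine {Xf : G → PBond (F.P K) 0 → lieSU (Fin N)} {g₀ : G} (Zf : G →L[ℝ] (ConstrSetB 𝔅 k → lieSU (Fin N)))
    (havg : ∀ᶠ g in 𝓝 g₀, ∀ s : ConstrSetB 𝔅 k, avgFamily (avOfRecord F N K) (expChart U (Xf g)) s.1 s.2.1 = expSU (Zf (g - g₀) s) * W s.1 s.2.1) :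
    ∀ᶠ g in 𝓝 g₀, msChartB F N K k 𝔅 W U (Xf g) = 0 +
      (ContinuousLinearMap.pi fun i : Fin (constrCardB 𝔅 k) =>
        (specialUnitaryAd (W ((constrEnumB 𝔅 k).symm i).1 ((constrEnumB 𝔅 k).symm i).2.1)⁻¹).toContinuousLinearEquiv.toContinuousLinearMap.comp
          ((ContinuousLinearMap.proj ((constrEnumB 𝔅 k).symm i)).comp Zf)) (g - g₀) := by
  filter_upwards [havg, eventually_norm_coe_apply_lt_log_two_constrB Zf g₀] with g hg hZ
  rw [zero_add, msChartB_eq_ad_of_avg_eq hZ hg]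
  rfl

/-- ★★★ **THE SECOND DERIVATIVE OF THE CHART ALONG SUCH A FAMILY VANISHES**: `D²(msChartB ∘ X_f)(g₀)[h,h′] = 0`.
[cite: Balaban1989LargeFieldII, (1.7) p.358, (1.12)–(1.13) p.359; Balaban1985Variational, (82)–(83) p.290, (174)–(177) pp.305–306] -/
theorem fderiv_fderiv_msChartB_family_eq_zero {Xf : G → PBond (F.P K) 0 → lieSU (Fin N)} {g₀ : G} (Zf : G →L[ℝ] (ConstrSetB 𝔅 k → lieSU (Fin N)))
    (havg : ∀ᶠ g in 𝓝 g₀, ∀ s : ConstrSetB 𝔅 k, avgFamily (avOfRecord F N K) (expChart U (Xf g)) s.1 s.2.1 = expSU (Zf (g - g₀) s) * W s.1 s.2.1)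
    (h h' : G) :
    fderiv ℝ (fun g => fderiv ℝ (fun g => msChartB F N K k 𝔅 W U (Xf g)) g) g₀ h h' = 0 :=
  B16Ineq17NearFlatOneSidedDatum.fderiv_fderiv_datum_eq_zero_of_eventually_affine _ (eventually_msChartB_family_eq_affine Zf havg) h h'

/-- ★★★ **THE SKELETON'S AFFINE-DATUM BINDER `haff` HOLDS IDENTICALLY IN THE CHART OF RECORD**: for EVERY functional `λ₀` and all directions,
`λ₀ (D²(msChartB ∘ X_f)(g₀)[h,h′]) = 0` — the hypothesis `haff` of `B16Ineq17NearFlatOneSidedSeminorm.hessian_value_criticalFamily_ge_flatMin_sub_seminorm` ∕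
`B16Ineq17NearFlatWilsonLetters.hessian_wilsonAction4_criticalExpChartFamily_ge_flatMin_sub` ∕ `B15Prop1SliceHessianOfChartFamily.h17Shape_sliceFn_of_nearFlatCriticalExpChartFamily`
at `Ψ := msChartB F N K k 𝐁 W U₀`, discharged from the family-on-fibre letter `havg` alone (no curvature term, no extra error letter).
[cite: Balaban1989LargeFieldII, (1.7) p.358, (1.12)–(1.13) p.359; Balaban1985Variational, Sect. C (47)–(48) p.285, (82)–(83) p.290] -/
theorem haff_msChartB_of_avg_family {Xf : G → PBond (F.P K) 0 → lieSU (Fin N)} {g₀ : G} (Zf : G →L[ℝ] (ConstrSetB 𝔅 k → lieSU (Fin N)))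
    (havg : ∀ᶠ g in 𝓝 g₀, ∀ s : ConstrSetB 𝔅 k, avgFamily (avOfRecord F N K) (expChart U (Xf g)) s.1 s.2.1 = expSU (Zf (g - g₀) s) * W s.1 s.2.1)
    (lam : (Fin (constrCardB 𝔅 k) → lieSU (Fin N)) →L[ℝ] ℝ) (h h' : G) :
    lam (fderiv ℝ (fun g => fderiv ℝ (fun g => msChartB F N K k 𝔅 W U (Xf g)) g) g₀ h h') = 0 := by
  rw [fderiv_fderiv_msChartB_family_eq_zero Zf havg, map_zero]

/-- ★★ **THE FIRST DERIVATIVE OF THE CHART ALONG THE FAMILY IS THE TWISTED EMBEDDING**: `HasFDerivAt (msChartB ∘ X_f) ℓ g₀`, `ℓ h = (Ad_{W_j(c)⁻¹}(Z h)_{(j,c)})_{(j,c)}`.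
[cite: Balaban1985Variational, (82)–(83) p.290; Balaban1989LargeFieldII, p.359] -/
theorem hasFDerivAt_msChartB_family {Xf : G → PBond (F.P K) 0 → lieSU (Fin N)} {g₀ : G} (Zf : G →L[ℝ] (ConstrSetB 𝔅 k → lieSU (Fin N)))
    (havg : ∀ᶠ g in 𝓝 g₀, ∀ s : ConstrSetB 𝔅 k, avgFamily (avOfRecord F N K) (expChart U (Xf g)) s.1 s.2.1 = expSU (Zf (g - g₀) s) * W s.1 s.2.1) :
    HasFDerivAt (fun g => msChartB F N K k 𝔅 W U (Xf g))
      (ContinuousLinearMap.pi fun i : Fin (constrCardB 𝔅 k) =>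
        (specialUnitaryAd (W ((constrEnumB 𝔅 k).symm i).1 ((constrEnumB 𝔅 k).symm i).2.1)⁻¹).toContinuousLinearEquiv.toContinuousLinearMap.comp
          ((ContinuousLinearMap.proj ((constrEnumB 𝔅 k).symm i)).comp Zf)) g₀ := by
  set ℓ : G →L[ℝ] (Fin (constrCardB 𝔅 k) → lieSU (Fin N)) := ContinuousLinearMap.pi fun i : Fin (constrCardB 𝔅 k) =>
    (specialUnitaryAd (W ((constrEnumB 𝔅 k).symm i).1 ((constrEnumB 𝔅 k).symm i).2.1)⁻¹).toContinuousLinearEquiv.toContinuousLinearMap.comp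
      ((ContinuousLinearMap.proj ((constrEnumB 𝔅 k).symm i)).comp Zf) with hℓ
  have hev := eventually_msChartB_family_eq_affine (U := U) (W := W) Zf havg
  have hlin : HasFDerivAt (fun g : G => (0 : Fin (constrCardB 𝔅 k) → lieSU (Fin N)) + ℓ (g - g₀)) ℓ g₀ := by
    have h1 : HasFDerivAt (fun g : G => ℓ (g - g₀)) (ℓ.comp (ContinuousLinearMap.id ℝ G)) g₀ :=
      ℓ.hasFDerivAt.comp g₀ ((hasFDerivAt_id g₀).sub_const g₀)
    rw [ContinuousLinearMap.comp_id] at h1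
    exact h1.const_add _
  exact hlin.congr_of_eventuallyEq hev

/-- `fderiv` form of `hasFDerivAt_msChartB_family`, evaluated: `D(msChartB ∘ X_f)(g₀) h = (Ad_{W_j(c)⁻¹}(Z h)_{(j,c)})_{(j,c)}`. [cite: Balaban1985Variational, (82)–(83) p.290; Balaban1989LargeFieldII, p.359] -/
theorem fderiv_msChartB_family_apply {Xf : G → PBond (F.P K) 0 → lieSU (Fin N)} {g₀ : G} (Zf : G →L[ℝ] (ConstrSetB 𝔅 k → lieSU (Fin N)))
    (havg : ∀ᶠ g in 𝓝 g₀, ∀ s : ConstrSetB 𝔅 k, avgFamily (avOfRecord F N K) (expChart U (Xf g)) s.1 s.2.1 = expSU (Zf (g - g₀) s) * W s.1 s.2.1) (h : G) :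
    fderiv ℝ (fun g => msChartB F N K k 𝔅 W U (Xf g)) g₀ h = fun i =>
      specialUnitaryAd (W ((constrEnumB 𝔅 k).symm i).1 ((constrEnumB 𝔅 k).symm i).2.1)⁻¹ (Zf h ((constrEnumB 𝔅 k).symm i)) := by
  rw [(hasFDerivAt_msChartB_family Zf havg).fderiv]
  rfl

/-- ★★ **THE DATUM VELOCITY OF THE FAMILY IS THE TWISTED LIE ELEMENT** (the `y` of the Federbush fibre letter `hm`∕`hy`): if moreover `X_f` is differentiable at `g₀` with
derivative `X_f′` and the chart is differentiable at `X_f g₀`, then `D(msChartB)(X_f g₀)(X_f′ h) = (Ad_{W_j(c)⁻¹}(Z h)_{(j,c)})_{(j,c)}` for every direction `h` (chain rule +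
uniqueness of the derivative). [cite: Balaban1985Variational, (82)–(83) p.290; Balaban1989LargeFieldII, (1.12) p.359] -/
theorem fderiv_msChartB_comp_apply_eq_ad {Xf : G → PBond (F.P K) 0 → lieSU (Fin N)} {g₀ : G} (Zf : G →L[ℝ] (ConstrSetB 𝔅 k → lieSU (Fin N)))
    (havg : ∀ᶠ g in 𝓝 g₀, ∀ s : ConstrSetB 𝔅 k, avgFamily (avOfRecord F N K) (expChart U (Xf g)) s.1 s.2.1 = expSU (Zf (g - g₀) s) * W s.1 s.2.1)
    {X' : G →L[ℝ] PBond (F.P K) 0 → lieSU (Fin N)} (hX : HasFDerivAt Xf X' g₀)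
    (hΨ : DifferentiableAt ℝ (msChartB F N K k 𝔅 W U) (Xf g₀)) (h : G) :
    fderiv ℝ (msChartB F N K k 𝔅 W U) (Xf g₀) (X' h) = fun i =>
      specialUnitaryAd (W ((constrEnumB 𝔅 k).symm i).1 ((constrEnumB 𝔅 k).symm i).2.1)⁻¹ (Zf h ((constrEnumB 𝔅 k).symm i)) := by
  have hcomp : HasFDerivAt (fun g => msChartB F N K k 𝔅 W U (Xf g)) ((fderiv ℝ (msChartB F N K k 𝔅 W U) (Xf g₀)).comp X') g₀ :=
    hΨ.hasFDerivAt.comp g₀ hX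
  rw [← fderiv_msChartB_family_apply Zf havg h, hcomp.fderiv, ContinuousLinearMap.comp_apply]

end Family

end Literature.MathematicalPhysics.QuantumFieldTheory.Balaban1983to89.Node00

end
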